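import Literature.AlgebraicGeometry.RelativeSpec.EquivariantModuleDescent
import Literature.AlgebraicGeometry.Modules.AffineVectorBundleSections
import Literature.AlgebraicGeometry.Modules.PullbackFrame
import Literature.AlgebraicGeometry.Modules.RankOneCocycle
import Literature.AlgebraicGeometry.Modules.DetClassOfIso
import Mathlib.AlgebraicGeometry.Morphisms.Flat
import Mathlib.Data.Finsupp.ToDFinsupp
import HarnessLib

/-!
# Rank descent along a free finite quotient: `(p_* E)^G` is locally free of rank `r` if `E` is

Let `p : X ⟶ Q` be an AFFINE GEOMETRIC QUOTIENT of the scheme `X` by a finite group `G`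
(`ρ : ActionOver p G`, `ρ.IsGeometricQuotient p`, `IsAffineHom p`) whose action is FREE on the
affine charts (for `V ⊆ Q` affine and `g ≠ 1` the `g · b - b`, `b ∈ Γ(X, p⁻¹V)`, generate the
unit ideal), and let `E` be an `𝒪_X`-module with a `G`-equivariant structure `φ` (unit and
cocycle conditions `hunit`, `hcocycle` of `RelativeSpec/EquivariantModuleInvariants`). The file
`RelativeSpec/EquivariantModuleDescent` proves `p^* (p_* E)^G ≅ E` ((T1), Galois descent of
quasi-coherent modules). This file adds the RANK statement needed to descend LINE BUNDLES (and
vector bundles of any constant rank):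

* `ActionOver.finite_projective_sections_moduleInvariants` — over `V ⊆ Q` with the free
  condition, if the sections `Γ(E, p⁻¹V)` form a finite projective `Γ(X, p⁻¹V)`-module then the
  sections `Γ((p_* E)^G, V)` form a finite projective `Γ(Q, V)`-module: `Γ((p_* E)^G, V) ≅ M^G`
  for `M = Γ(E, p⁻¹V)` with its descent datum, `M^G` is finite over `A = Γ(Q, V)`
  (`GaloisAlgebras.finite_invariants_of_free`) and an `A`-direct summand of `M`
  (`GaloisAlgebras.exists_linearMap_apply_coe_eq_self_of_free`), and `M` is `A`-projective
  because `B = Γ(X, p⁻¹V)` is (`GaloisAlgebras.projective_of_free`; projectivity is transitive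
  along a tower — a private helper);
* `card_eq_of_free_iso_over_of_hasRank_pullback` — the size of a frame of `F` over `U ∋ f y` is
  the rank of `f^* F` (frames pull back, `Modules/PullbackFrame`; two frames over a non-empty
  open have the same size, `Modules/FrameTransition.rank_eq_of_nontrivial`);
* **`ActionOver.hasRank_moduleInvariants_of_free`** — if `E` has rank `r` (`Motives.HasRank`)
  then so has `(p_* E)^G = ρ.moduleInvariants E φ`: on an affine `V ∋ q` the sections are finite
  projective (first bullet with Görtz–Wedhorn I Cor. 7.42, `Modules/AffineVectorBundleSections`),
  hence `(p_* E)^G` is framed on a basic open `D(s) ∋ q`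
  (`exists_free_over_basicOpen_of_projective_sections`), and the frame has size `r` by the
  second bullet applied to `p^* (p_* E)^G ≅ E` at a point of the (non-empty) fibre of the
  surjective `p`; `hasRank_moduleInvariants_of_free'` is the same statement in the binder shape
  announced on the cell bus (with the idle binders `[Flat p]`, `[E.IsQuasicoherent]`), and
  `exists_descent_of_free_of_hasRank` is (T1) `exists_descent_of_free` with the rank recorded:
  a rank-`r` equivariant `E` is `p^* F` for a quasi-coherent `F` OF RANK `r`, compatibly with `φ`.

This is the finite-group-quotient case of the descent of local freeness of given rank along
faithfully flat quasi-compact morphisms (SGA 1 VIII Prop. 1.10 and the remark following it;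
EGA IV₂ Prop. 2.5.2), proved here through Chase–Harrison–Rosenberg rather than fpqc descent;
the typical consumer is the construction of the Poincaré bundle by descending the Mumford bundle
along the free quotient `1 × π : A × A → A × Â` (Mumford, *Abelian Varieties* §13).
Everything is proved; no named facts, no definitions.

## References

* [SGA1] A. Grothendieck, M. Raynaud, SGA 1, Exp. VIII Thm. 1.1, Prop. 1.10 ("Descente de
  propriétés de Modules": type fini, présentation finie, localement libre de type fini / de rang
  donné `n`).
* [MumfordAV1970] D. Mumford, *Abelian Varieties* (1970), §7 Thm. p. 66, §12 Thm. 1 (p. 112),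
  §13.
* [Greither1992CyclicGalois] C. Greither, LNM 1534 (1992), Ch. 0 Thm. 1.6 (iii), Thm. 7.1.
* [GortzWedhorn2020] U. Görtz, T. Wedhorn, *Algebraic Geometry I*, 2nd ed., Cor. 7.42.
* [StacksProject] Tag 01C8 (pull-back of locally free modules of rank `n`).
-/

noncomputable section

-- `TopCat.Presheaf`/`Scheme.Modules` are not reducible (as in Mathlib's
-- `AlgebraicGeometry/Modules`).
set_option backward.isDefEq.respectTransparency false

universe u

open CategoryTheory Limits AlgebraicGeometry TopologicalSpace Opposite
open Literature.AlgebraicGeometry.Modules Literature.AlgebraicGeometry.Motives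

/-! ### Algebra: projectivity is transitive; projectivity descends to the invariants -/

namespace Literature.AlgebraicGeometry.RelativeSpec

/-- **Projectivity is transitive along a tower of rings**: if `B` is a projective `A`-module and
`M` is a projective `B`-module then `M` is a projective `A`-module (`M` is a `B`-direct summand of
the free module `M →₀ B`, which as an `A`-module is a direct sum of copies of the projective `B`).
Private: plumbing for `projective_invariants_of_free`. [folklore] -/
private theorem projective_of_isScalarTower_of_projective (A B M : Type*) [CommRing A]
    [CommRing B] [Algebra A B] [AddCommGroup M] [Module A M] [Module B M] [IsScalarTower A B M]
    [Module.Projective A B] [Module.Projective B M] : Module.Projective A M := by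
  classical
  obtain ⟨s, hs⟩ := ‹Module.Projective B M›
  haveI : Module.Projective A (M →₀ B) :=
    Module.Projective.of_equiv' (finsuppLequivDFinsupp (M := B) (ι := M) A).symm
  refine Module.Projective.of_split (s.restrictScalars A)
    ((Finsupp.linearCombination B (id : M → M)).restrictScalars A) ?_
  ext m
  exact hs m

/-- **Projectivity descends to the invariants** (complement to
`GaloisAlgebras.finite_invariants_of_free`): for a free action of the finite group `G` on `B`
with `B^G = A ⊆ B` and a projective `B`-module `M` with a descent datum, the invariants `M^G` form
a projective `A`-module — `B` is `A`-projective (Greither Ch. 0 Thm. 1.6 (iii),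
`GaloisAlgebras.projective_of_free`), so `M` is `A`-projective, and `M^G` is an `A`-direct summand
of `M` by the trace retraction (Greither Ch. 0 Thm. 7.1; Chase–Harrison–Rosenberg Lemma 1.6).
[cite: Greither1992CyclicGalois, Ch. 0 Thm. 7.1 (pp. 28–29)] -/
theorem projective_invariants_of_free (A : Type*) {B : Type*} [CommRing A] [CommRing B]
    [Algebra A B] (G : Type*) [Group G] [MulSemiringAction G B] {M : Type*} [AddCommGroup M]
    [Module B M] [DistribMulAction G M] [SMulCommClass G A B] [Module A M] [IsScalarTower A B M]
    [SMulDistribClass G B M] [Fintype G] [Algebra.IsInvariant A B G] [FaithfulSMul A B]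
    [Module.Projective B M]
    (hfree : ∀ g : G, g ≠ 1 → Ideal.span (Set.range fun b : B ↦ g • b - b) = ⊤)
    (N : Submodule A M) (hN : ∀ m : M, m ∈ N ↔ ∀ g : G, g • m = m) :
    Module.Projective A N := by
  haveI : Module.Projective A B := Literature.RingTheory.GaloisAlgebras.projective_of_free A G hfree
  haveI : Module.Projective A M := projective_of_isScalarTower_of_projective A B M
  obtain ⟨π, hπ⟩ :=
    Literature.RingTheory.GaloisAlgebras.exists_linearMap_apply_coe_eq_self_of_free A G hfree N hN
  exact Module.Projective.of_split N.subtype π (LinearMap.ext fun n ↦ hπ n)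

/-! ### Frames: the size of a frame is detected after a pull-back hitting it -/

/-- **The size of a frame of `F` over `U` equals the rank of `f^* F`** as soon as `U` meets
the image of `f`: the frame pulls back to a frame of `f^* F ≅ E` over `f⁻¹U`
(`Modules/PullbackFrame`), and over the non-empty open `f⁻¹U ∩ U_y` it is compared with a
rank-`r` frame of `E` (`Modules/FrameTransition.rank_eq_of_nontrivial`: invariant basis number
of the non-trivial ring `Γ(Y, f⁻¹U ∩ U_y)`).
[cite: StacksProject, Tag 01C8 (Modules, Lemma 17.14.3)] -/
theorem card_eq_of_free_iso_over_of_hasRank_pullback {X Y : Scheme.{u}} (f : Y ⟶ X)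
    {F : X.Modules} {E : Y.Modules} (eF : (Scheme.Modules.pullback f).obj F ≅ E) {r : ℕ}
    (hE : HasRank E r) {U : X.Opens} {ι : Type u} [Finite ι]
    (e : SheafOfModules.free ι ≅ F.over U) {y : Y} (hy : f.base y ∈ U) : Nat.card ι = r := by
  obtain ⟨FE, hFE⟩ := exists_frameSystem_of_hasRank hE
  obtain ⟨e₁⟩ := nonempty_pullback_overIso f e
  let e₂ : SheafOfModules.free ι ≅ E.over (f ⁻¹ᵁ U) :=
    e₁ ≪≫ (Scheme.Modules.overFunctor (f ⁻¹ᵁ U)).mapIso eF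
  let W : Y.Opens := f ⁻¹ᵁ U ⊓ FE.U y
  haveI : Nonempty W := ⟨⟨y, hy, FE.mem y⟩⟩
  have h := rank_eq_of_nontrivial e₂ (FE.frame y) (Finite.equivFin ι) (FE.enum y)
    (homOfLE (inf_le_left : W ≤ f ⁻¹ᵁ U)) (homOfLE (inf_le_right : W ≤ FE.U y))
  rw [h]
  exact hFE y

namespace ActionOver

variable {X Q : Scheme.{u}} {p : X ⟶ Q} {G : Type u} [Group G] (ρ : ActionOver p G)
variable (E : X.Modules) (φ : ∀ g : G, (Scheme.Modules.pullback (ρ.aut g).hom).obj E ≅ E)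

/-! ### Finite projective sections descend to the invariants -/

/-- **Finite projectivity of sections descends to `(p_* E)^G`.** Over an open `V ⊆ Q` on
whose chart `p⁻¹V` the action is free (Chase–Harrison–Rosenberg), if `Γ(E, p⁻¹V)` is a finite
projective `Γ(X, p⁻¹V)`-module then `Γ((p_* E)^G, V)` is a finite projective `Γ(Q, V)`-module:
with `A = Γ(Q, V) ↪ B = Γ(X, p⁻¹V)` (`B^G = A`, free action) and `M = Γ(E, p⁻¹V)` with its
descent datum `g • m = g⁻¹ · m`, the sections of the invariants are `M^G`
(`mem_range_moduleInvariantsι_app_iff`), which is finite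
(`GaloisAlgebras.finite_invariants_of_free`) and projective (`projective_invariants_of_free`)
over `A`. [cite: Greither1992CyclicGalois, Ch. 0 Thm. 7.1 (pp. 28–29)] -/
theorem finite_projective_sections_moduleInvariants [Fintype G] (hq : ρ.IsGeometricQuotient p)
    {V : Q.Opens}
    (hfreeV : ∀ g : G, g ≠ 1 →
      Ideal.span (Set.range fun b : Γ(X, p ⁻¹ᵁ V) ↦ ρ.act g V b - b) = ⊤)
    (hunit : (φ 1).hom = ((Scheme.Modules.pullbackCongr ρ.aut_one_hom).app E).hom ≫
      ((Scheme.Modules.pullbackId X).app E).hom)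
    (hcocycle : ∀ g h : G, (φ (g * h)).hom =
      ((Scheme.Modules.pullbackCongr (ρ.aut_mul_hom g h)).app E).hom ≫
        ((Scheme.Modules.pullbackComp (ρ.aut h).hom (ρ.aut g).hom).app E).inv ≫
          (Scheme.Modules.pullback (ρ.aut h).hom).map (φ g).hom ≫ (φ h).hom)
    [Module.Finite Γ(X, p ⁻¹ᵁ V) Γ(E, p ⁻¹ᵁ V)]
    [Module.Projective Γ(X, p ⁻¹ᵁ V) Γ(E, p ⁻¹ᵁ V)] :
    Module.Finite Γ(Q, V) Γ(ρ.moduleInvariants E φ, V) ∧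
      Module.Projective Γ(Q, V) Γ(ρ.moduleInvariants E φ, V) := by
  classical
  set F := ρ.moduleInvariants E φ
  set ι := ρ.moduleInvariantsι E φ with hι
  -- the rings `A = Γ(Q, V) → B = Γ(X, p⁻¹V)` with the free `G`-action on `B`
  letI : Algebra Γ(Q, V) Γ(X, p ⁻¹ᵁ V) := (p.app V).hom.toAlgebra
  letI : MulSemiringAction G Γ(X, p ⁻¹ᵁ V) := ρ.mulSemiringAction V
  haveI : SMulCommClass G Γ(Q, V) Γ(X, p ⁻¹ᵁ V) :=
    ⟨fun g a b => by
      change ρ.act g V (p.app V a * b) = p.app V a * ρ.act g V b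
      exact ρ.act_app_mul g V a b⟩
  haveI : Algebra.IsInvariant Γ(Q, V) Γ(X, p ⁻¹ᵁ V) G :=
    ⟨fun b hb => hq.exists_app_eq V b fun g _ => hb g⟩
  haveI : FaithfulSMul Γ(Q, V) Γ(X, p ⁻¹ᵁ V) :=
    (faithfulSMul_iff_algebraMap_injective _ _).mpr (hq.app_injective V)
  have hfree' : ∀ g : G, g ≠ 1 →
      Ideal.span (Set.range fun b : Γ(X, p ⁻¹ᵁ V) ↦ g • b - b) = ⊤ := hfreeV
  -- the module `M = Γ(E, p⁻¹V)` with its descent datum `g • m = (g⁻¹) · m`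
  letI : Module Γ(Q, V) Γ(E, p ⁻¹ᵁ V) := Module.compHom _ (p.app V).hom
  haveI : IsScalarTower Γ(Q, V) Γ(X, p ⁻¹ᵁ V) Γ(E, p ⁻¹ᵁ V) :=
    ⟨fun a b m => mul_smul (p.app V a) b m⟩
  letI : DistribMulAction G Γ(E, p ⁻¹ᵁ V) :=
    { smul := fun g m => ρ.actSections E φ g⁻¹ V m
      one_smul := fun m => by
        change ρ.actSections E φ 1⁻¹ V m = m
        rw [inv_one]; exact ρ.actSections_one E φ hunit V m
      mul_smul := fun g h m => by
        change ρ.actSections E φ (g * h)⁻¹ V m =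
          ρ.actSections E φ g⁻¹ V (ρ.actSections E φ h⁻¹ V m)
        rw [mul_inv_rev]; exact ρ.actSections_mul E φ hcocycle h⁻¹ g⁻¹ V m
      smul_zero := fun g => map_zero _
      smul_add := fun g m m' => map_add _ m m' }
  haveI : SMulDistribClass G Γ(X, p ⁻¹ᵁ V) Γ(E, p ⁻¹ᵁ V) :=
    ⟨fun g b m => by
      change ρ.actSections E φ g⁻¹ V (b • m) =
        ρ.act g V b • ρ.actSections E φ g⁻¹ V m
      rw [actSections_smul]; rfl⟩
  -- the invariants `N = M^G`: finite and projective over `A`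
  obtain ⟨N, hN⟩ :=
    Literature.RingTheory.GaloisAlgebras.exists_submodule_mem_iff_forall_smul_eq Γ(Q, V) G
      (B := Γ(X, p ⁻¹ᵁ V)) (M := Γ(E, p ⁻¹ᵁ V))
  haveI : Module.Finite Γ(Q, V) N :=
    Literature.RingTheory.GaloisAlgebras.finite_invariants_of_free Γ(Q, V) G hfree' N hN
  haveI : Module.Projective Γ(Q, V) N := projective_invariants_of_free Γ(Q, V) G hfree' N hN
  -- `Γ(F, V) ≅ N` through the inclusion `ι`
  have hNι : ∀ m : Γ(E, p ⁻¹ᵁ V), m ∈ N ↔ m ∈ Set.range (ι.app V) := by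
    intro m
    rw [hN, hι, ρ.mem_range_moduleInvariantsι_app_iff E φ V m]
    constructor
    · intro h g
      have h' := h g⁻¹
      change ρ.actSections E φ g⁻¹⁻¹ V m = m at h'
      rwa [inv_inv] at h'
    · intro h g; exact h g⁻¹
  let f : Γ(F, V) →ₗ[Γ(Q, V)] N :=
    { toFun := fun y => ⟨ι.app V y, (hNι _).mpr ⟨y, rfl⟩⟩
      map_add' := fun y y' => Subtype.ext (map_add _ y y')
      map_smul' := fun a y => Subtype.ext (by
        change ι.app V (a • y) = a • ι.app V y
        rw [Scheme.Modules.Hom.app_smul]) }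
  have hf : Function.Bijective f := by
    refine ⟨fun y y' h => ρ.moduleInvariantsι_app_injective E φ V ?_, fun n => ?_⟩
    · have h' := congrArg Subtype.val h
      exact h'
    · obtain ⟨y, hy⟩ := (hNι _).mp n.2
      exact ⟨y, Subtype.ext hy⟩
  let eN : Γ(F, V) ≃ₗ[Γ(Q, V)] N := LinearEquiv.ofBijective f hf
  exact ⟨Module.Finite.equiv eN.symm, Module.Projective.of_equiv' eN.symm⟩

/-! ### Rank descent -/

/-- **(β) RANK DESCENT along a free finite quotient.** For a finite group `G` acting on `X` over
`Q` with `p : X ⟶ Q` an affine geometric quotient (`IsGeometricQuotient`, `IsAffineHom`), free on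
the affine charts, and an `𝒪_X`-module `E` with a `G`-equivariant structure `φ` (unit/cocycle
conditions): if `E` is locally free of rank `r` then so is the module of invariants
`(p_* E)^G = ρ.moduleInvariants E φ` (the descended module of (T1) `exists_descent_of_free`:
`p^* (p_* E)^G ≅ E`). Proof: on an affine `V ∋ q`, `Γ(E, p⁻¹V)` is finite projective
(Görtz–Wedhorn I Cor. 7.42, `p⁻¹V` affine), hence so is `Γ((p_* E)^G, V)`
(`finite_projective_sections_moduleInvariants`), so `(p_* E)^G` is framed on some `D(s) ∋ q`;
the frame has size `r` since it pulls back to a frame of `p^* (p_* E)^G ≅ E` over the non-empty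
`p⁻¹D(s)` (`p` is surjective). The finite-group case of SGA 1 VIII Prop. 1.10 (local freeness
of given rank descends along faithfully flat quasi-compact morphisms, there by fpqc descent);
Mumford, *Abelian Varieties* §12 Thm. 1 / §13 for line bundles along `X → X/G`.
[cite: SGA1, Exp. VIII Prop. 1.10] -/
theorem hasRank_moduleInvariants_of_free [Fintype G] [IsAffineHom p]
    (hq : ρ.IsGeometricQuotient p)
    (hfree : ∀ (V : Q.Opens), IsAffineOpen V → ∀ g : G, g ≠ 1 →
      Ideal.span (Set.range fun b : Γ(X, p ⁻¹ᵁ V) ↦ ρ.act g V b - b) = ⊤)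
    (hunit : (φ 1).hom = ((Scheme.Modules.pullbackCongr ρ.aut_one_hom).app E).hom ≫
      ((Scheme.Modules.pullbackId X).app E).hom)
    (hcocycle : ∀ g h : G, (φ (g * h)).hom =
      ((Scheme.Modules.pullbackCongr (ρ.aut_mul_hom g h)).app E).hom ≫
        ((Scheme.Modules.pullbackComp (ρ.aut h).hom (ρ.aut g).hom).app E).inv ≫
          (Scheme.Modules.pullback (ρ.aut h).hom).map (φ g).hom ≫ (φ h).hom)
    {r : ℕ} (hE : HasRank E r) :
    HasRank (ρ.moduleInvariants E φ) r := by
  classical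
  set F := ρ.moduleInvariants E φ
  have hEfl : IsFiniteLocallyFree E := HasRank.isFiniteLocallyFree' hE
  haveI := hEfl.isVectorBundle.1
  have hEal : IsAffineLocalizing E := IsAffineLocalizing.of_isQuasicoherent E
  have hFal : IsAffineLocalizing F := ρ.isAffineLocalizing_moduleInvariants E φ hEal
  haveI := ρ.isIso_descentHom E φ hq hfree hEal hunit hcocycle
  let eF : (Scheme.Modules.pullback p).obj F ≅ E := asIso (ρ.descentHom E φ)
  -- at every point: a frame of size `r` on a basic open of an affine neighbourhood
  have key : ∀ q : Q, ∃ (U : Q.Opens) (ι : Type u) (_ : SheafOfModules.free ι ≅ F.over U),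
      q ∈ U ∧ ∃ _ : Finite ι, Nat.card ι = r := by
    intro q
    obtain ⟨V, hV, hqV, -⟩ :=
      exists_isAffineOpen_mem_and_subset (U := ⊤) (Opens.mem_top q)
    obtain ⟨hfin, hproj⟩ :=
      finite_projective_sections_of_isFiniteLocallyFree hEfl (hV.preimage p)
    obtain ⟨hFfin, hFproj⟩ :=
      ρ.finite_projective_sections_moduleInvariants E φ hq (hfree V hV) hunit hcocycle
    obtain ⟨s, hqs, ι, hι, ⟨e⟩⟩ :=
      exists_free_over_basicOpen_of_projective_sections hFal hV hqV
    obtain ⟨x, hx⟩ := hq.surjective q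
    have hxU : p.base x ∈ Q.basicOpen s := by rw [hx]; exact hqs
    exact ⟨Q.basicOpen s, ι, e, hqs, hι,
      card_eq_of_free_iso_over_of_hasRank_pullback p eF hE e hxU⟩
  choose U ι e hqU hι hcard using key
  exact FrameSystem.hasRank
    { U := U
      mem := hqU
      I := ι
      rank := fun _ => r
      enum := fun q => Finite.equivFinOfCardEq (hcard q)
      frame := e } r fun _ => rfl

/-- **(β) in the binder shape announced on the cell bus** (B-plan1 M1PRIME-DAG §9, signature
`RankDescentOfFree`): the same statement with the instance binders `[Flat p]` and
`[E.IsQuasicoherent]`, which are idle (quasi-coherence follows from `HasRank`, and only the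
surjectivity of the quotient map is used). [cite: MumfordAV1970, §12 Thm. 1 (p. 112)] -/
theorem hasRank_moduleInvariants_of_free' :
    ∀ [Fintype G] [IsAffineHom p] [Flat p], ρ.IsGeometricQuotient p →
      (∀ (V : Q.Opens), IsAffineOpen V → ∀ g : G, g ≠ 1 →
        Ideal.span (Set.range fun b : Γ(X, p ⁻¹ᵁ V) ↦ ρ.act g V b - b) = ⊤) →
      ∀ (E : X.Modules) [E.IsQuasicoherent]
        (φ : ∀ g : G, (Scheme.Modules.pullback (ρ.aut g).hom).obj E ≅ E),
        (φ 1).hom = ((Scheme.Modules.pullbackCongr ρ.aut_one_hom).app E).hom ≫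
          ((Scheme.Modules.pullbackId X).app E).hom →
        (∀ g h : G, (φ (g * h)).hom =
          ((Scheme.Modules.pullbackCongr (ρ.aut_mul_hom g h)).app E).hom ≫
            ((Scheme.Modules.pullbackComp (ρ.aut h).hom (ρ.aut g).hom).app E).inv ≫
              (Scheme.Modules.pullback (ρ.aut h).hom).map (φ g).hom ≫ (φ h).hom) →
        ∀ r : ℕ, HasRank E r → HasRank (ρ.moduleInvariants E φ) r :=
  fun hq hfree E _ φ hunit hcocycle _ hE =>
    ρ.hasRank_moduleInvariants_of_free E φ hq hfree hunit hcocycle hE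

/-- **(T1) with the rank recorded: a rank-`r` equivariant module descends to a rank-`r`
module.** For an affine geometric quotient `p : X ⟶ Q` by a free finite group action and an
`𝒪_X`-module `E` of rank `r` with a `G`-equivariant structure `φ`, there is a quasi-coherent
`F` on `Q` OF RANK `r` with `p^* F ≅ E` compatibly with the equivariant structures (namely
`F = (p_* E)^G`; `exists_descent_of_free` + `hasRank_moduleInvariants_of_free`). For `r = 1`:
`G`-linearised line bundles on `X` are pull-backs of line bundles on `X/G` (Mumford, *Abelian
Varieties* §12 Thm. 1, §13). [cite: MumfordAV1970, §12 Thm. 1 (p. 112)] -/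
theorem exists_descent_of_free_of_hasRank [Fintype G] [IsAffineHom p]
    (hq : ρ.IsGeometricQuotient p)
    (hfree : ∀ (V : Q.Opens), IsAffineOpen V → ∀ g : G, g ≠ 1 →
      Ideal.span (Set.range fun b : Γ(X, p ⁻¹ᵁ V) ↦ ρ.act g V b - b) = ⊤)
    (hunit : (φ 1).hom = ((Scheme.Modules.pullbackCongr ρ.aut_one_hom).app E).hom ≫
      ((Scheme.Modules.pullbackId X).app E).hom)
    (hcocycle : ∀ g h : G, (φ (g * h)).hom =
      ((Scheme.Modules.pullbackCongr (ρ.aut_mul_hom g h)).app E).hom ≫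
        ((Scheme.Modules.pullbackComp (ρ.aut h).hom (ρ.aut g).hom).app E).inv ≫
          (Scheme.Modules.pullback (ρ.aut h).hom).map (φ g).hom ≫ (φ h).hom)
    {r : ℕ} (hE : HasRank E r) :
    ∃ (F : Q.Modules) (_ : F.IsQuasicoherent) (_ : HasRank F r)
      (e : (Scheme.Modules.pullback p).obj F ≅ E),
      ∀ g : G, (Scheme.Modules.pullback (ρ.aut g).hom).map e.hom ≫ (φ g).hom =
        ((Scheme.Modules.pullbackComp (ρ.aut g).hom p).app F ≪≫
          (Scheme.Modules.pullbackCongr (ρ.aut_comp g)).app F).hom ≫ e.hom := by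
  have hEfl : IsFiniteLocallyFree E := HasRank.isFiniteLocallyFree' hE
  haveI := hEfl.isVectorBundle.1
  have hEal : IsAffineLocalizing E := IsAffineLocalizing.of_isQuasicoherent E
  haveI := ρ.isIso_descentHom E φ hq hfree hEal hunit hcocycle
  exact ⟨ρ.moduleInvariants E φ,
    isQuasicoherent_of_isAffineLocalizing (ρ.isAffineLocalizing_moduleInvariants E φ hEal),
    ρ.hasRank_moduleInvariants_of_free E φ hq hfree hunit hcocycle hE,
    asIso (ρ.descentHom E φ), fun g => ρ.pullback_map_descentHom_comp E φ g⟩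

end ActionOver

end Literature.AlgebraicGeometry.RelativeSpec

end
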